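import Summits.QuantumFields.YangMills.Theorems.BalabanUVNodesN14AtTopBornTowerGuard

/-!
# DAG node N14 · NE1′ — THE SOURCE TOWER OF RECORD `ne1OfRecord l₀ Λ`, READ FROM THE DATUM: the N14 object of record WITH DATUM CONTENT under
# director-ym №195 (8) reading (a); `N14At` on it from the datum's own loop-variable bound; the guard of record via cutoff `0`; the pin shape
# `Ne1PinnedOfRecord 𝔯` (plan g80 WORDS-1a (t-N14) material)

Cell `pub-ymgap`, YM-PLAN Track A (HUMAN RULING D-0062 ∕ D-0149, director-ym №197), width seat `pub-ymgap-dag-n14-w1` (generation 2), FILE 3 of the seat.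
THEOREMS + five `def`s; imports FILE 2 `BalabanUVNodesN14AtTopBornTowerGuard` (p586623) ONLY; modifies nothing; `--supports` K3⁷ `SpineGivenEndpointR13SepCoPH`
(stmt-QuantumFields-20544) `--as helper` — COUNT-NEUTRAL.

WHY.  K3⁷ v2 OF RECORD (plan g79, 145a664ea9c38a7b) conjoins the N14 GUARD `Ne1NondegenerateOn` where `∃ 𝔯` stands because no `ne1` OBJECT OF RECORD exists
to pin by name; FILE 1's `ne1UnitScale l₀ M Λ` (p584515) is a CONSTANT model (ignores `(F, θ, hP, g₀, os)`) — ref-N READ-26 ∕ plan g80 WORDS-1a: «MODEL-LEVEL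
inhabitant … (t-N14): `ne1` gets a by-name pin when an N14 object of record WITH DATUM CONTENT lands».  Under reading (a) (LENS control v5.1 (E4)∕(E6)) that
object is typable from tree declarations alone: at `(F, θ, hP, g₀, os)` the record's observable-attached dressed term is the ONE insertion `t·F_K`,
`F_K = T4GenFunBounds.prodObs ((datumOfRecord₁₃CoPH F N θ hP).scheme g₀) K os` (the product of the datum's AVERAGED LOOP VARIABLES `FiniteEpsData.avgObs`) —
exactly the exponent of `schemeZ ((datumOfRecord₁₃CoPH F N θ hP).scheme g₀) os K t = ∫ e^{t·F_K} e^{−β_K A}` that K3⁷ v2's `KeyedExtraction` represents by the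
spine sums — booked AT the unit lattice with its SUP-SIZE `|t| · sup_U |F_K U|` (`T4TermFormat.Booking.size` = the booked sup-size of the term).

* §1 [decided model] `unitScaleTowerK ι a` — FILE 1's `unitScaleTower` with CUTOFF-DEPENDENT sizes (`unitScaleTowerK_const`, `rfl`); top-born, `N14At`, rate clause.
* §2 [bookkeeping] `obsSupNorm S K os := ⨆ U, |prodObs S K os U|` (any `TorusScheme`): nonnegative; under `|obs| ≤ 1` dominates `|F_K U|` and is `≤ 1`.
* §3 [decided model + bookkeeping] `sourceTowerOfRecord S l₀ os`: `abs_exponent_le_size` (booked size DOMINATES the dressed exponent), top-born, budget `l₀`,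
  `n14At_sourceTowerOfRecord`, rate clause, `NotVacuum` from ONE cutoff with `0 < obsSupNorm`, `Nondegenerate → 0 < l₀`, domination by FILE 1's `sourceTower l₀ 1`.
* §4 [datum content] `FiniteEpsData`: `obsSupNorm (D.scheme g₀) K os ≤ 1` with NO hypothesis (`abs_avgObs_le_one`, normalized traces); ★ `obsSupNorm_scheme_zero`:
  AT CUTOFF `0` it is EXACTLY `1` for every string (`Averaging.iter _ 0 = id`, `holAt 1 = 1`, `GaugeGroup.reTr_one`).
* §5 [object of record] ★ `ne1OfRecord l₀ Λ F θ hP g₀ os` (READS `θ ∕ hP` through the datum's scheme, `g₀`, `os`; letters `l₀`, `Λ`): ★★ `n14At_ne1OfRecord`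
  (`0 ≤ l₀`, `0 ≤ Λ`, EVERY tuple), ★ `nondegenerate_ne1OfRecord` (dag-n14-w2's GUARD OF RECORD p584216 PASSES for `0 < l₀`) + `_iff`,
  `not_nondegeneratePerScale_ne1OfRecord`, `rateCovers_ne1OfRecord`, `dressedBudget_ne1OfRecord`; against the model pin `size_ne1OfRecord_le_unitScale`
  (DOMINATED by `ne1UnitScale l₀ 1 Λ`), `size_ne1OfRecord_zero` (EQUAL at cutoff `0`; nothing claimed at `K ≥ 1` — `Setup.Averaging` does not pin `sup|avgObs|`).
* §6 [reading level] `s_N14_rRec₁₃CoPHOn_of_ne1OfRecord`, `s_N14_rRec₁₃CoPH_of_ne1OfRecord`, `ne1NondegenerateOn_of_ne1OfRecord`; the PIN SHAPE ★ `Ne1PinnedOfRecord 𝔯`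
  (mirror of v2's `N15PinnedSized 𝔯`), `ne1PinnedOfRecord_mk` (A6 inhabitant), ★★ `guard_and_s_N14_of_ne1PinnedOfRecord`, ★★ `n14At_rateCarriersOfRecord₁₃CoPH_of_pinned`
  (the N14 conjunct of `RatesHolderAt` IN THE BUNDLE CURRENCY — the shape of v2's `n15At_rrOfRecord_of_pinned`), `nondegenerate_rateCarriersOfRecord₁₃CoPH_of_pinned`.

HONEST FRAMING.  An OBJECT with datum content plus decided ∕ bookkeeping facts about it.  Reading (a) is the director's ADOPTED TABLE READING; under it
`N14At` on the object IS the observable budget and the datum supplies it.  NOT a claim that N14 is discharged (the chair books after acts (i)–(v); dag-lead's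
model∕object rule decides what a pin is worth); NE1′ for SUB-UNIT observables NOT PRINTED ([Balaban1989LargeFieldII] (1.73)–(1.75) pp. 379–380 type the action
only) and NOT PROVED; nothing of Bałaban's run is used beyond `FiniteEpsData.abs_avgObs_le_one` and `Averaging.iter _ 0 = id`; FILE 1's §4 LOCATED applies;
K3⁷ OPEN, not claimed; counts unmoved (typed 28∕28 · discharged 5∕27, A 5∕28).  The Yang–Mills mass gap (Clay) is NOT proved by any of this — R4 closes the
conditional finite-𝕋⁴ rung `BalabanLadder.UV` only; NOT ℝ⁴, NOT OS, NOT a mass gap.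
-/


noncomputable section

namespace YMDAG.N14.TopBorn

open Finset
open scoped BigOperators
open Literature.MathematicalPhysics.QuantumFieldTheory.Balaban1983to89
open Literature.MathematicalPhysics.QuantumFieldTheory.Balaban1983to89.T4Continuum
open Literature.MathematicalPhysics.QuantumFieldTheory.Balaban1983to89.T4TermFormat
open Literature.MathematicalPhysics.QuantumFieldTheory.Balaban1983to89.Missing (TorusScheme)
open Literature.MathematicalPhysics.QuantumFieldTheory.Balaban1983to89.T4GenFunBounds (prodObs abs_prodObs_le_one)
open Summit.QuantumFields.BalabanUV.T4Continuum.NE1p.DressedRoot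
open YMDAG.UVSplit
open YMDAG.N14.TowerGuard (BirthsNonempty NotVacuum Nondegenerate NondegeneratePerScale RateCovers Ne1NondegenerateOn
  dressedBudget_of_n14At_rateCovers)
open Node00 (Stage13HParams RateObjects₁₁ datumOfRecord₁₃CoPH)

/-! ## §1 The unit-scale tower with cutoff-dependent sizes (decided model) -/

section UnitScaleK
variable {P : Type} (ι : Type) [Fintype ι] (a : P → ℕ → ι → ℝ) (ha : ∀ p K i, 0 ≤ a p K i)
/-- **THE UNIT-SCALE TOWER WITH CUTOFF-DEPENDENT SIZES** [decided model]: at run parameter `p` and cutoff `K` FILE 1's `unitScaleBooking` (insertions `ι`,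
all born AT the final scale `K`, one unit-lattice cube feeling them) with sizes `a p K i` that may read the cutoff.  Nothing of Bałaban's run is modelled. [folklore] -/
def unitScaleTowerK : DressedTower P where
  B := fun p K => unitScaleBooking ι (a p K) (ha p K) K
  K_eq := fun _ _ => rfl
  T := fun p K => unitScaleTrajectory ι (a p K) (ha p K) K

/-- The cutoff-constant case IS FILE 1's `unitScaleTower` (`rfl`). [folklore] -/
theorem unitScaleTowerK_const (a₀ : P → ι → ℝ) (ha₀ : ∀ p i, 0 ≤ a₀ p i) :
    unitScaleTowerK ι (fun p _ => a₀ p) (fun p _ => ha₀ p) = unitScaleTower ι a₀ ha₀ := rfl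

/-- The tower is top-born (`rfl` per birth). [folklore] -/
theorem towerTopBorn_unitScaleTowerK : TowerTopBorn (unitScaleTowerK ι a ha) := fun _ _ _ => rfl

/-- A uniform bound on the sizes bounds the top sizes. [folklore] -/
theorem towerTopSizeLe_unitScaleTowerK {A₀ : ℝ} (hA : ∀ p K i, a p K i ≤ A₀) : TowerTopSizeLe (unitScaleTowerK ι a ha) A₀ :=
  fun p K i => hA p K i

/-- **`N14At` AT THE CARRIERS** `⟨P, unitScaleTowerK ι a ha, Λ⟩` at every `Λ ≥ 0` from the budget `a p K i ≤ A₀` (FILE 1's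
`dressedStabilityStrict_of_topBorn`). [folklore] -/
theorem n14At_unitScaleTowerK {A₀ Λ : ℝ} (hA₀ : 0 ≤ A₀) (hA : ∀ p K i, a p K i ≤ A₀) (hΛ : 0 ≤ Λ) :
    N14At ⟨P, unitScaleTowerK ι a ha, Λ⟩ :=
  dressedStabilityStrict_of_topBorn hA₀ hΛ (towerTopBorn_unitScaleTowerK ι a ha) (towerTopSizeLe_unitScaleTowerK ι a ha hA)

/-- The booked size of insertion `i` at cutoff `K` IS `a p K i` at every scale (`rfl`). [folklore] -/
theorem size_unitScaleTowerK (p : P) (K : ℕ) (i : ι) (k : ℕ) : ((unitScaleTowerK ι a ha).B p K).size i k = a p K i := rfl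

/-- With an insertion present every booking of the tower has its member. [folklore] -/
theorem birthsNonempty_unitScaleTowerK [Nonempty ι] : BirthsNonempty (unitScaleTowerK ι a ha) :=
  fun _ _ => ⟨Classical.arbitrary ι⟩

/-- **THE RATE CLAUSE AT MULTIPLICITY `card ι`** [decided]: all insertions are felt at the one unit-lattice cube; every `Λ ≥ 0`. [folklore] -/
theorem rateCovers_unitScaleTowerK {Λ : ℝ} (hΛ : 0 ≤ Λ) : RateCovers ⟨P, unitScaleTowerK ι a ha, Λ⟩ (Fintype.card ι) := by
  refine ⟨Nat.cast_nonneg _, fun p K q j => ?_⟩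
  show (((Finset.univ : Finset ι).filter fun _ => K = j).card : ℝ) ≤ (Fintype.card ι : ℝ) * Λ ^ (K - j)
  by_cases hj : K = j
  · subst hj
    simp
  · rw [Finset.filter_eq_empty_iff.mpr fun _ _ => hj, Finset.card_empty, Nat.cast_zero]
    exact mul_nonneg (Nat.cast_nonneg _) (pow_nonneg hΛ _)
end UnitScaleK

/-! ## §2 The sup-size of a scheme's product observable on the final field space (bookkeeping) -/

section ObsSup
variable {G : Type*} {O : Type*} (S : TorusScheme G O)
/-- **THE SUP-SIZE OF THE PRODUCT OBSERVABLE** `F_K = prodObs S K os` of a string `os` at step `K`: `sup_U |F_K U|` over the `K`-th field space (Mathlib's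
conditionally complete `⨆`; for observables bounded by `1` the honest sup-norm, `abs_prodObs_le_obsSupNorm` ∕ `obsSupNorm_le_one`). [folklore] -/
def obsSupNorm (K : ℕ) (os : List O) : ℝ := ⨆ U : GaugeField (S.P K) 0 G, |prodObs S K os U|

/-- The sup-size is nonnegative (no boundedness needed). [folklore] -/
theorem obsSupNorm_nonneg (K : ℕ) (os : List O) : 0 ≤ obsSupNorm S K os :=
  Real.iSup_nonneg fun _ => abs_nonneg _

/-- Under `|obs| ≤ 1` the sup-size DOMINATES `|F_K U|` at every configuration. [folklore] -/
theorem abs_prodObs_le_obsSupNorm (h1 : ∀ K o U, |S.obs K o U| ≤ 1) (K : ℕ) (os : List O) (U : GaugeField (S.P K) 0 G) :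
    |prodObs S K os U| ≤ obsSupNorm S K os :=
  le_ciSup (f := fun U : GaugeField (S.P K) 0 G => |prodObs S K os U|)
    ⟨1, by rintro _ ⟨V, rfl⟩; exact abs_prodObs_le_one S h1 K os V⟩ U

/-- Under `|obs| ≤ 1` the sup-size is `≤ 1` (the field space is inhabited by the trivial configuration). [folklore] -/
theorem obsSupNorm_le_one [GaugeGroup G] (h1 : ∀ K o U, |S.obs K o U| ≤ 1) (K : ℕ) (os : List O) : obsSupNorm S K os ≤ 1 :=
  ciSup_le fun U => abs_prodObs_le_one S h1 K os U

/-- Under `|obs| ≤ 1`, a configuration where `|F_K| = 1` pins the sup-size at `1`. [folklore] -/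
theorem obsSupNorm_eq_one_of_abs_eq_one [GaugeGroup G] (h1 : ∀ K o U, |S.obs K o U| ≤ 1) (K : ℕ) (os : List O)
    (U : GaugeField (S.P K) 0 G) (hU : |prodObs S K os U| = 1) : obsSupNorm S K os = 1 :=
  le_antisymm (obsSupNorm_le_one S h1 K os) (hU ▸ abs_prodObs_le_obsSupNorm S h1 K os U)
end ObsSup

/-! ## §3 The source tower of a scheme's string: one insertion, the dressed exponent, booked at the unit lattice with its sup-size -/

section SourceOfRecord
variable {G : Type*} {O : Type*} (S : TorusScheme G O) (l₀ : ℝ) (os : List O)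
/-- **THE SOURCE TOWER OF A SCHEME'S STRING** [decided model + bookkeeping]: run parameter the source `t`, `|t| ≤ l₀`; ONE insertion — the dressed exponent
`t·F_K` of `schemeZ S os K t = ∫ e^{t·F_K} e^{−β_K A}` (`T4GenFunBounds` :474), `F_K = prodObs S K os` — born AT the final scale `K` with booked size its sup-size
`|t| · obsSupNorm S K os`.  Reading (a): the factor multiplies the FINAL unit-lattice density and enters no bracket below it. [folklore] -/
def sourceTowerOfRecord : DressedTower {t : ℝ // |t| ≤ l₀} :=
  unitScaleTowerK Unit (fun t K _ => |t.1| * obsSupNorm S K os) fun t K _ => mul_nonneg (abs_nonneg t.1) (obsSupNorm_nonneg S K os)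

variable {S l₀ os}
/-- The booked size at source `t`, cutoff `K` IS `|t| · sup_U |F_K U|` (`rfl`). [folklore] -/
theorem size_sourceTowerOfRecord (t : {t : ℝ // |t| ≤ l₀}) (K : ℕ) (b : ((sourceTowerOfRecord S l₀ os).B t K).Birth) (k : ℕ) :
    ((sourceTowerOfRecord S l₀ os).B t K).size b k = |t.1| * obsSupNorm S K os := rfl

/-- **THE BOOKED SIZE DOMINATES THE DRESSED EXPONENT** [bookkeeping]: `|t · F_K U| ≤ size` at every configuration `U` (observables bounded by `1`). [folklore] -/
theorem abs_exponent_le_size (h1 : ∀ K o U, |S.obs K o U| ≤ 1) (t : {t : ℝ // |t| ≤ l₀}) (K : ℕ)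
    (b : ((sourceTowerOfRecord S l₀ os).B t K).Birth) (k : ℕ) (U : GaugeField (S.P K) 0 G) :
    |t.1 * prodObs S K os U| ≤ ((sourceTowerOfRecord S l₀ os).B t K).size b k := by
  rw [size_sourceTowerOfRecord, abs_mul]
  exact mul_le_mul_of_nonneg_left (abs_prodObs_le_obsSupNorm S h1 K os U) (abs_nonneg _)

variable (S l₀ os)
/-- The source tower is top-born. [folklore] -/
theorem towerTopBorn_sourceTowerOfRecord : TowerTopBorn (sourceTowerOfRecord S l₀ os) :=
  towerTopBorn_unitScaleTowerK Unit _ _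

/-- **THE OBSERVABLE BUDGET** [bookkeeping]: observables bounded by `1` give top sizes `≤ l₀`. [folklore] -/
theorem towerTopSizeLe_sourceTowerOfRecord [GaugeGroup G] (h1 : ∀ K o U, |S.obs K o U| ≤ 1) :
    TowerTopSizeLe (sourceTowerOfRecord S l₀ os) l₀ :=
  towerTopSizeLe_unitScaleTowerK Unit _ _ fun t K _ =>
    (mul_le_mul_of_nonneg_left (obsSupNorm_le_one S h1 K os) (abs_nonneg t.1)).trans (by rw [mul_one]; exact t.2)

/-- **`N14At` AT THE SOURCE-TOWER CARRIERS** [bookkeeping]: observables bounded by `1`, `0 ≤ l₀`, every rate `Λ ≥ 0`. [folklore] -/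
theorem n14At_sourceTowerOfRecord [GaugeGroup G] (h1 : ∀ K o U, |S.obs K o U| ≤ 1) (hl₀ : 0 ≤ l₀) {Λ : ℝ} (hΛ : 0 ≤ Λ) :
    N14At ⟨{t : ℝ // |t| ≤ l₀}, sourceTowerOfRecord S l₀ os, Λ⟩ :=
  n14At_of_topBorn _ hl₀ hΛ (towerTopBorn_sourceTowerOfRecord S l₀ os) (towerTopSizeLe_sourceTowerOfRecord S l₀ os h1)

/-- The rate clause at multiplicity `1` (one insertion, one cube), every `Λ ≥ 0`. [folklore] -/
theorem rateCovers_sourceTowerOfRecord {Λ : ℝ} (hΛ : 0 ≤ Λ) : RateCovers ⟨{t : ℝ // |t| ≤ l₀}, sourceTowerOfRecord S l₀ os, Λ⟩ 1 := by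
  have h : RateCovers ⟨{t : ℝ // |t| ≤ l₀}, sourceTowerOfRecord S l₀ os, Λ⟩ (Fintype.card Unit) :=
    rateCovers_unitScaleTowerK Unit _ _ hΛ
  simpa only [Fintype.card_unit, Nat.cast_one] using h

/-- Every booking of the source tower has its member (the insertion). [folklore] -/
theorem birthsNonempty_sourceTowerOfRecord : BirthsNonempty (sourceTowerOfRecord S l₀ os) :=
  birthsNonempty_unitScaleTowerK Unit _ _

/-- **NOT THE VACUUM FROM ONE CUTOFF** [bookkeeping]: a positive window and ONE cutoff `K` with positive sup-size make the insertion at `t = l₀` book `> 0`. [folklore] -/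
theorem notVacuum_sourceTowerOfRecord_of_pos (hl₀ : 0 < l₀) {K : ℕ} (hK : 0 < obsSupNorm S K os) :
    NotVacuum (sourceTowerOfRecord S l₀ os) :=
  ⟨⟨l₀, by rw [abs_of_pos hl₀]⟩, K, (), K, le_rfl, le_rfl, by
    rw [size_sourceTowerOfRecord, abs_of_pos hl₀]
    exact mul_pos hl₀ hK⟩

/-- **CONVERSELY THE GUARD FORCES A POSITIVE WINDOW** [decided]: a positive booked size `|t| · sup|F_K| > 0` needs `t ≠ 0` in the window. [folklore] -/
theorem pos_of_nondegenerate_sourceTowerOfRecord {Λ : ℝ} (h : Nondegenerate ⟨{t : ℝ // |t| ≤ l₀}, sourceTowerOfRecord S l₀ os, Λ⟩) :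
    0 < l₀ := by
  obtain ⟨-, -, t, K, b, k, -, -, hpos⟩ := h
  have hpos' : 0 < |t.1| * obsSupNorm S K os := hpos
  rcases pos_and_pos_or_neg_and_neg_of_mul_pos hpos' with ⟨ht, -⟩ | ⟨-, hK⟩
  · exact ht.trans_le t.2
  · exact absurd hK (not_lt.mpr (obsSupNorm_nonneg S K os))

/-- **DOMINATED BY FILE 1's SOURCE TOWER WITH OBSERVABLE BOUND `1`** [bookkeeping]: size `|t|·sup|F_K| ≤ |t|·1`. [folklore] -/
theorem size_sourceTowerOfRecord_le [GaugeGroup G] (h1 : ∀ K o U, |S.obs K o U| ≤ 1) (t : {t : ℝ // |t| ≤ l₀}) (K : ℕ) (b : Unit) (k : ℕ) :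
    ((sourceTowerOfRecord S l₀ os).B t K).size b k ≤ ((sourceTower l₀ 1 zero_le_one).B t K).size b k := by
  rw [size_sourceTowerOfRecord, size_sourceTower]
  exact mul_le_mul_of_nonneg_left (obsSupNorm_le_one S h1 K os) (abs_nonneg t.1)
end SourceOfRecord

/-! ## §4 Datum content: a `FiniteEpsData` scheme's observables are bounded by `1`, and at cutoff `0` the sup-size is exactly `1` -/

section DatumContent
/-- Holonomies of the trivial configuration are trivial (local copy of `T3DescentFibreTower.holAt_one`, not imported here). [folklore] -/
private theorem holAt_one_loc {G : Type*} [GaugeGroup G] {P : Params} {j : ℕ} (γ : List (LStep P j)) : holAt (1 : GaugeField P j G) γ = 1 := by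
  induction γ with
  | nil => exact holAt_nil _
  | cons s γ ih =>
    rw [holAt_cons, ih, mul_one]
    show (if s.fwd then (1 : G) else (1 : G)⁻¹) = 1
    rw [inv_one]
    split_ifs <;> rfl

variable {F : T4Family} {G : Type*} [GaugeGroup G] [MeasurableSpace G] [HaarData G] (D : FiniteEpsData F G)
/-- **AT CUTOFF `0` EVERY AVERAGED LOOP VARIABLE OF THE TRIVIAL CONFIGURATION IS `1`** [datum content]: the `0`-fold averaged configuration is the configuration
itself (`Averaging.iter _ 0 = id`, `Setup` :306) and `Re tr 1∕N = 1` (`GaugeGroup.reTr_one`). [folklore] -/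
theorem avgObs_zero_one (C : ULoop F) : D.avgObs 0 C 1 = 1 := by
  show GaugeGroup.reTr (holAt (1 : GaugeField (F.P 0) 0 G) (C.1.atLevel 0)) = 1
  rw [holAt_one_loc, GaugeGroup.reTr_one]

/-- … hence the product observable of EVERY string at cutoff `0` is `1` at the trivial configuration. [folklore] -/
theorem prodObs_scheme_zero_one (g₀ : ℕ → ℝ) (os : List (ULoop F)) : prodObs (D.scheme g₀) 0 os 1 = 1 := by
  show (os.map fun o => D.avgObs 0 o 1).prod = 1
  apply List.prod_eq_one
  intro x hx
  obtain ⟨o, -, rfl⟩ := List.mem_map.mp hx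
  exact avgObs_zero_one D o

variable [RegularGaugeGroup G]
/-- **THE DATUM's SUP-SIZE IS AT MOST `1` — NO HYPOTHESIS** [datum content]: averaged loop variables are normalized traces
(`FiniteEpsData.abs_avgObs_le_one`, `T4Continuum` :1293). [folklore] -/
theorem obsSupNorm_scheme_le_one (g₀ : ℕ → ℝ) (K : ℕ) (os : List (ULoop F)) : obsSupNorm (D.scheme g₀) K os ≤ 1 :=
  obsSupNorm_le_one (D.scheme g₀) (fun K C U => D.abs_avgObs_le_one K C U) K os

/-- **AT CUTOFF `0` THE DATUM's SUP-SIZE IS EXACTLY `1`, EVERY STRING** [datum content]. [folklore] -/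
theorem obsSupNorm_scheme_zero (g₀ : ℕ → ℝ) (os : List (ULoop F)) : obsSupNorm (D.scheme g₀) 0 os = 1 :=
  obsSupNorm_eq_one_of_abs_eq_one (D.scheme g₀) (fun K C U => D.abs_avgObs_le_one K C U) 0 os 1
    (by rw [prodObs_scheme_zero_one, abs_one])
end DatumContent

/-! ## §5 THE N14 OBJECT OF RECORD: the source tower read from the datum of record -/

section Record
variable {N : ℕ} [NeZero N]
/-- **THE SOURCE TOWER OF RECORD — N14's CARRIERS READ FROM THE DATUM** [object of record, reading (a)]: at `(F, θ, hP, g₀, os)` the source window `|t| ≤ l₀`,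
the source tower of the string `os` in the scheme OF THE DATUM OF RECORD `(datumOfRecord₁₃CoPH F N θ hP).scheme g₀` — one insertion, the dressed exponent `t·F_K`
of `schemeZ ((datumOfRecord₁₃CoPH F N θ hP).scheme g₀) os K t`, `F_K` the product of the datum's averaged loop variables, booked at the unit lattice with its
sup-size — and the positional rate `Λ`.  Letters `l₀`, `Λ`; everything else is READ.  Under director-ym №195 (8) reading (a) this is the record's
observable-attached dressed tower; nothing else of Bałaban's run is asserted. [folklore] -/
def ne1OfRecord (l₀ Λ : ℝ) (F : T4Family) (θ : Stage13HParams F N) (hP : θ.Provisos₁₃CoPH F N) (g₀ : ℕ → ℝ) (os : List (ULoop F)) :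
    NE1pCarriers :=
  ⟨{t : ℝ // |t| ≤ l₀}, sourceTowerOfRecord ((datumOfRecord₁₃CoPH F N θ hP).scheme g₀) l₀ os, Λ⟩

variable {l₀ Λ : ℝ} (F : T4Family) (θ : Stage13HParams F N) (hP : θ.Provisos₁₃CoPH F N) (g₀ : ℕ → ℝ) (os : List (ULoop F))
/-- **THE DATUM CONTENT, DISPLAYED** [object of record]: the booked size at source `t`, cutoff `K` IS `|t| · sup_U |∏_{C ∈ os} avgObs_K(C)(U)|` (`rfl`). [folklore] -/
theorem size_ne1OfRecord (t : {t : ℝ // |t| ≤ l₀}) (K : ℕ) (b : Unit) (k : ℕ) :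
    ((ne1OfRecord l₀ Λ F θ hP g₀ os).𝒯.B t K).size b k = |t.1| * obsSupNorm ((datumOfRecord₁₃CoPH F N θ hP).scheme g₀) K os := rfl

/-- **THE BOOKED SIZE DOMINATES THE DRESSED EXPONENT OF THE RECORD's `schemeZ`** [object of record]: `|t · F_K U| ≤ size`, every `U`, NO hypothesis. [folklore] -/
theorem abs_exponent_le_size_ne1OfRecord (t : {t : ℝ // |t| ≤ l₀}) (K : ℕ) (b : Unit) (k : ℕ) (U : GaugeField (F.P K) 0 (SU N)) :
    |t.1 * prodObs ((datumOfRecord₁₃CoPH F N θ hP).scheme g₀) K os U| ≤ ((ne1OfRecord l₀ Λ F θ hP g₀ os).𝒯.B t K).size b k :=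
  abs_exponent_le_size (S := (datumOfRecord₁₃CoPH F N θ hP).scheme g₀) (l₀ := l₀) (os := os)
    (fun K C U => (datumOfRecord₁₃CoPH F N θ hP).abs_avgObs_le_one K C U) t K b k U

/-- The object of record is top-born. [folklore] -/
theorem towerTopBorn_ne1OfRecord : TowerTopBorn (ne1OfRecord l₀ Λ F θ hP g₀ os).𝒯 :=
  towerTopBorn_sourceTowerOfRecord _ l₀ os

/-- **THE OBSERVABLE BUDGET OF THE RECORD** [object of record]: top sizes `≤ l₀`, NO hypothesis (normalized traces). [folklore] -/
theorem towerTopSizeLe_ne1OfRecord : TowerTopSizeLe (ne1OfRecord l₀ Λ F θ hP g₀ os).𝒯 l₀ :=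
  towerTopSizeLe_sourceTowerOfRecord _ l₀ os fun K C U => (datumOfRecord₁₃CoPH F N θ hP).abs_avgObs_le_one K C U

/-- **ROOT-C OF RECORD ON THE OBJECT OF RECORD, AT EVERY TUPLE** [object of record + bookkeeping]: `N14At (ne1OfRecord l₀ Λ F θ hP g₀ os)` for `0 ≤ l₀`, `0 ≤ Λ` —
from the datum's own loop-variable bound; the NE1′ apparatus for sub-unit observables is not used (reading (a)). [folklore] -/
theorem n14At_ne1OfRecord (hl₀ : 0 ≤ l₀) (hΛ : 0 ≤ Λ) : N14At (ne1OfRecord l₀ Λ F θ hP g₀ os) :=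
  n14At_sourceTowerOfRecord _ l₀ os (fun K C U => (datumOfRecord₁₃CoPH F N θ hP).abs_avgObs_le_one K C U) hl₀ hΛ

/-- **THE GUARD OF RECORD PASSES** (dag-n14-w2's `Nondegenerate`, p584216) [object of record + datum content]: for `0 < l₀` at EVERY tuple — window inhabited,
every booking has its member, and at cutoff `0` the insertion at the source `t = l₀` books `l₀ · 1 > 0`. [folklore] -/
theorem nondegenerate_ne1OfRecord (hl₀ : 0 < l₀) : Nondegenerate (ne1OfRecord l₀ Λ F θ hP g₀ os) :=
  ⟨nonempty_sourceWindow hl₀.le, birthsNonempty_sourceTowerOfRecord _ l₀ os,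
    notVacuum_sourceTowerOfRecord_of_pos _ l₀ os hl₀ (K := 0) (by
      rw [obsSupNorm_scheme_zero]
      exact one_pos)⟩

/-- **THE WINDOW LETTER HAS CONTENT** [decided]: the object of record passes the guard of record IFF `0 < l₀`. [folklore] -/
theorem nondegenerate_ne1OfRecord_iff : Nondegenerate (ne1OfRecord l₀ Λ F θ hP g₀ os) ↔ 0 < l₀ :=
  ⟨fun h => pos_of_nondegenerate_sourceTowerOfRecord _ l₀ os h, fun h => nondegenerate_ne1OfRecord F θ hP g₀ os h⟩

/-- … and FAILS dag-n14-w2's per-scale variant (top-born; FILE 2's `not_memberPerScale_of_topBorn`). [folklore] -/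
theorem not_nondegeneratePerScale_ne1OfRecord (hl₀ : 0 ≤ l₀) : ¬ NondegeneratePerScale (ne1OfRecord l₀ Λ F θ hP g₀ os) := fun h =>
  haveI : Nonempty (ne1OfRecord l₀ Λ F θ hP g₀ os).P := nonempty_sourceWindow hl₀
  not_memberPerScale_of_topBorn (towerTopBorn_ne1OfRecord F θ hP g₀ os) h.2.1

/-- The rate clause at multiplicity `1` for the object of record, every `Λ ≥ 0`. [folklore] -/
theorem rateCovers_ne1OfRecord (hΛ : 0 ≤ Λ) : RateCovers (ne1OfRecord l₀ Λ F θ hP g₀ os) 1 :=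
  rateCovers_sourceTowerOfRecord _ l₀ os hΛ

/-- **ROOT-B ON THE OBJECT OF RECORD** [bookkeeping]: `DressedBudget` for every run-weight profile in `[0, w̄]` (w2's `dressedBudget_of_n14At_rateCovers`). [folklore] -/
theorem dressedBudget_ne1OfRecord (hl₀ : 0 ≤ l₀) (hΛ : 0 ≤ Λ) {wbar : ℝ} {w : {t : ℝ // |t| ≤ l₀} → ℕ → ℕ → ℝ} (hwbar : 0 ≤ wbar)
    (hw0 : ∀ p K, ∀ j ≤ K, 0 ≤ w p K j) (hwb : ∀ p K, ∀ j ≤ K, w p K j ≤ wbar) : DressedBudget (ne1OfRecord l₀ Λ F θ hP g₀ os).𝒯 w :=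
  dressedBudget_of_n14At_rateCovers (c := ne1OfRecord l₀ Λ F θ hP g₀ os) (n14At_ne1OfRecord F θ hP g₀ os hl₀ hΛ)
    (rateCovers_ne1OfRecord F θ hP g₀ os hΛ) hwbar hw0 hwb

/-- **AGAINST THE MODEL PIN — DOMINATED** [bookkeeping]: the object of record books at most what FILE 1's `ne1UnitScale l₀ 1 Λ` books. [folklore] -/
theorem size_ne1OfRecord_le_unitScale (t : {t : ℝ // |t| ≤ l₀}) (K : ℕ) (b : Unit) (k : ℕ) :
    ((ne1OfRecord l₀ Λ F θ hP g₀ os).𝒯.B t K).size b k ≤ ((ne1UnitScale (N := N) l₀ 1 Λ zero_le_one F θ hP g₀ os).𝒯.B t K).size b k :=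
  size_sourceTowerOfRecord_le _ l₀ os (fun K C U => (datumOfRecord₁₃CoPH F N θ hP).abs_avgObs_le_one K C U) t K b k

/-- **AGAINST THE MODEL PIN — EQUAL AT CUTOFF `0`** [datum content]: the object of record books exactly `|t|` at cutoff `0`, as `ne1UnitScale l₀ 1 Λ` does; at
`K ≥ 1` nothing is claimed (`Setup.Averaging` does not pin `sup |avgObs|` there). [folklore] -/
theorem size_ne1OfRecord_zero (t : {t : ℝ // |t| ≤ l₀}) (b : Unit) (k : ℕ) :
    ((ne1OfRecord l₀ Λ F θ hP g₀ os).𝒯.B t 0).size b k = ((ne1UnitScale (N := N) l₀ 1 Λ zero_le_one F θ hP g₀ os).𝒯.B t 0).size b k := by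
  rw [size_ne1OfRecord, obsSupNorm_scheme_zero]
  rfl
end Record

/-! ## §6 Reading level: `S_N14`, the keyed guard, the pin shape `Ne1PinnedOfRecord`, and the N14 conjunct in the bundle currency -/

section Reading
variable {N : ℕ} [NeZero N] (𝔯 : RateReading₁₃CoPH N) (Rg : (F : T4Family) → Stage13HParams F N → Prop) {l₀ Λ : ℝ}
/-- **`S_N14` AT EVERY REGIME FOR A READING WHOSE `ne1` IS THE OBJECT OF RECORD** [bookkeeping]: `0 ≤ l₀`, `0 ≤ Λ` (dag-n14-c's `s_N14_rRec₁₃CoPHOn_of_n14At`). [folklore] -/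
theorem s_N14_rRec₁₃CoPHOn_of_ne1OfRecord (hl₀ : 0 ≤ l₀) (hΛ : 0 ≤ Λ)
    (h : ∀ (F : T4Family) (θ : Stage13HParams F N) (hP : θ.Provisos₁₃CoPH F N) (g₀ : ℕ → ℝ) (os : List (ULoop F)),
      𝔯.ne1 F θ hP g₀ os = ne1OfRecord l₀ Λ F θ hP g₀ os) :
    S_N14 (RRec₁₃CoPHOn 𝔯 Rg) :=
  s_N14_rRec₁₃CoPHOn_of_n14At 𝔯 Rg fun F θ hP _ _ g₀ os => by
    rw [h F θ hP g₀ os]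
    exact n14At_ne1OfRecord F θ hP g₀ os hl₀ hΛ

/-- … and at the canonical home `RRec₁₃CoPH 𝔯` (dag-n14-c's `s_N14_rRec₁₃CoPH_of_rRec₁₃CoPHOn_true`). [folklore] -/
theorem s_N14_rRec₁₃CoPH_of_ne1OfRecord (hl₀ : 0 ≤ l₀) (hΛ : 0 ≤ Λ)
    (h : ∀ (F : T4Family) (θ : Stage13HParams F N) (hP : θ.Provisos₁₃CoPH F N) (g₀ : ℕ → ℝ) (os : List (ULoop F)),
      𝔯.ne1 F θ hP g₀ os = ne1OfRecord l₀ Λ F θ hP g₀ os) :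
    S_N14 (RRec₁₃CoPH 𝔯) :=
  s_N14_rRec₁₃CoPH_of_rRec₁₃CoPHOn_true 𝔯 (s_N14_rRec₁₃CoPHOn_of_ne1OfRecord 𝔯 _ hl₀ hΛ h)

/-- **THE KEYED GUARD OF RECORD AT EVERY REGIME** for a reading whose `ne1` is the object of record, `0 < l₀`. [folklore] -/
theorem ne1NondegenerateOn_of_ne1OfRecord (hl₀ : 0 < l₀)
    (h : ∀ (F : T4Family) (θ : Stage13HParams F N) (hP : θ.Provisos₁₃CoPH F N) (g₀ : ℕ → ℝ) (os : List (ULoop F)),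
      𝔯.ne1 F θ hP g₀ os = ne1OfRecord l₀ Λ F θ hP g₀ os) :
    Ne1NondegenerateOn 𝔯 Rg := fun F θ hP _ _ g₀ os => by
  rw [h F θ hP g₀ os]
  exact nondegenerate_ne1OfRecord F θ hP g₀ os hl₀

/-- **THE (t-N14) PIN SHAPE** [shape]: the reading's N14 carriers at EVERY Stage-13 tuple with core provisos ARE the object of record `ne1OfRecord l₀ Λ` for
SOME `l₀ > 0`, `Λ ≥ 0` — the literal mirror of the K3⁷ v2 skeleton's `N15PinnedSized 𝔯` (a by-name pin replacing the conjoined guard, plan g80 WORDS-1a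
(w14′)∕(t-N14)); offered for a later skeleton edition, asserted of no reading here. [folklore] -/
def Ne1PinnedOfRecord (𝔯 : RateReading₁₃CoPH N) : Prop :=
  ∃ l₀ Λ : ℝ, 0 < l₀ ∧ 0 ≤ Λ ∧
    ∀ (F : T4Family) (θ : Stage13HParams F N) (hP : θ.Provisos₁₃CoPH F N) (g₀ : ℕ → ℝ) (os : List (ULoop F)),
      𝔯.ne1 F θ hP g₀ os = ne1OfRecord l₀ Λ F θ hP g₀ os

/-- **THE PIN IS INHABITED** (A6): the reading with any `lit` and `ne1 := ne1OfRecord l₀ Λ`, `0 < l₀`, `0 ≤ Λ`, carries it (`rfl`). [folklore] -/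
theorem ne1PinnedOfRecord_mk
    (lit : (F : T4Family) → (θ : Stage13HParams F N) → θ.Provisos₁₃CoPH F N → (ℕ → ℝ) → List (ULoop F) → RateObjects₁₁ N)
    (hl₀ : 0 < l₀) (hΛ : 0 ≤ Λ) : Ne1PinnedOfRecord (⟨lit, ne1OfRecord l₀ Λ⟩ : RateReading₁₃CoPH N) :=
  ⟨l₀, Λ, hl₀, hΛ, fun _ _ _ _ _ => rfl⟩

/-- **UNDER THE PIN: THE KEYED GUARD OF RECORD AND `S_N14`, JOINTLY, AT EVERY REGIME** [bookkeeping] — what K3⁷ v2's `GuardedReading` first conjunct and the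
N14 conjunct of `stub_rates13H` ask of such a reading. [folklore] -/
theorem guard_and_s_N14_of_ne1PinnedOfRecord (h : Ne1PinnedOfRecord 𝔯) :
    Ne1NondegenerateOn 𝔯 Rg ∧ S_N14 (RRec₁₃CoPHOn 𝔯 Rg) := by
  obtain ⟨l₀, Λ, hl₀, hΛ, hpin⟩ := h
  exact ⟨ne1NondegenerateOn_of_ne1OfRecord 𝔯 Rg hl₀ hpin, s_N14_rRec₁₃CoPHOn_of_ne1OfRecord 𝔯 Rg hl₀.le hΛ hpin⟩

/-- **UNDER THE PIN: THE N14 CONJUNCT IN THE BUNDLE CURRENCY** [bookkeeping]: `N14At (rateCarriersOfRecord₁₃CoPH 𝔯 F θ hP g₀ os k).ne1` at EVERY tuple and run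
length — the N14 slot of `RatesHolderAt` at the bundle of record (the shape of the skeleton's `n15At_rrOfRecord_of_pinned`; the bundle's `ne1` IS `𝔯.ne1 …`, `rfl`). [folklore] -/
theorem n14At_rateCarriersOfRecord₁₃CoPH_of_pinned (h : Ne1PinnedOfRecord 𝔯) (F : T4Family) (θ : Stage13HParams F N)
    (hP : θ.Provisos₁₃CoPH F N) (g₀ : ℕ → ℝ) (os : List (ULoop F)) (k : ℕ) :
    N14At (rateCarriersOfRecord₁₃CoPH 𝔯 F θ hP g₀ os k).ne1 := by
  obtain ⟨l₀, Λ, hl₀, hΛ, hpin⟩ := h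
  show N14At (𝔯.ne1 F θ hP g₀ os)
  rw [hpin F θ hP g₀ os]
  exact n14At_ne1OfRecord F θ hP g₀ os hl₀.le hΛ

/-- **UNDER THE PIN: THE GUARD IN THE BUNDLE CURRENCY** [bookkeeping]: `Nondegenerate (rateCarriersOfRecord₁₃CoPH 𝔯 F θ hP g₀ os k).ne1`. [folklore] -/
theorem nondegenerate_rateCarriersOfRecord₁₃CoPH_of_pinned (h : Ne1PinnedOfRecord 𝔯) (F : T4Family) (θ : Stage13HParams F N)
    (hP : θ.Provisos₁₃CoPH F N) (g₀ : ℕ → ℝ) (os : List (ULoop F)) (k : ℕ) :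
    Nondegenerate (rateCarriersOfRecord₁₃CoPH 𝔯 F θ hP g₀ os k).ne1 := by
  obtain ⟨l₀, Λ, hl₀, -, hpin⟩ := h
  show Nondegenerate (𝔯.ne1 F θ hP g₀ os)
  rw [hpin F θ hP g₀ os]
  exact nondegenerate_ne1OfRecord F θ hP g₀ os hl₀
end Reading

end YMDAG.N14.TopBorn

end
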